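import Summits.ValiantsHypothesis.ValiantsHypothesis.Theorems.DivisionGapPerDivisionHardStubSparseRigid

/-!
# Crux `DivisionGap.PerDivisionHard` (stmt-ValiantsHypothesis-5065), line `pair-descent-jss-endpoint` —
stub `stub_genericCut`: the generic weight cuts out a placed block face and its top fibre agrees
off the face

`stub_genericCut`: on any placed block graph `G = placedBlock eR eC` (`G(b,k) ⊕ M₀` with `k ≥ 1`,
the defs `BlockV`, `blockAdj`, `placedBlock`, `CutsOut` of `Theorems/DivisionGapDefs.lean`) and for
any `h ∈ ℝ≥0[x_ij]` all of whose monomials have the same degree, there is a weight `w` cutting out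
the face `G` of the Birkhoff polytope whose top fibre `topComponent w h` agrees off `G`.

Proof.  Take the generic weight `w = genericWeight G B`, `B = deg h + 1` (`W = B^{n²}` on `G`,
`W - B^{rank e}` off `G`; `StubSparseRigidCount.lean`).
1. It cuts out `G` (`cutsOut_genericWeight`) as soon as some permutation lies inside `G`; such a
   permutation comes from the diagonal perfect matching of `G(b,k) ⊕ M₀` for `k ≥ 1`
   (`exists_blockMatching`) transported along the placement (`exists_perm_mem_placedBlock`).
2. Two monomials of the top fibre are monomials of `h` (`support_topComponent_subset`), hence of
   the same degree, so they agree off `G` by base-`B` uniqueness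
   (`eq_offG_of_mem_support_topComponent`).
-/

noncomputable section

-- `Summit.ValiantsHypothesis.ValiantsHypothesis.…` is the tree's mandated single-conjunct layout
-- (Sub = Summit), so the duplicated namespace component is intended.
set_option linter.dupNamespace false

namespace Summit.ValiantsHypothesis.ValiantsHypothesis.Theorems.DivisionGapPerDivisionHard

open MvPolynomial Literature.Computability.AlgebraicComplexity
open Summit.ValiantsHypothesis.ValiantsHypothesis.Theorems.ZeroOneTransfer.Negative
open scoped NNReal

/-- **`stub_genericCut`.**  On any placed block `G = placedBlock eR eC` with `k ≥ 1` and for any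
`h` all of whose monomials have the same degree (e.g. torus-homogeneous `h`, or `h` supported on
permutation monomials), the generic weight `w = genericWeight G (deg h + 1)` (`W` on `G`,
`W - B^{rank e}` off `G`) CUTS OUT `G` (`cutsOut_genericWeight`: the placed graph contains a
perfect matching, `exists_blockMatching` + `exists_perm_mem_placedBlock`) and its top fibre AGREES
OFF `G` (`eq_offG_of_mem_support_topComponent`: base-`B` digits). [folklore] -/
theorem stub_genericCut :
    ∀ (b k m n : ℕ) (eR eC : BlockV b k m ≃ Fin n) (h : MvPolynomial (Fin n × Fin n) ℝ≥0),
      0 < k → (∀ m₁ ∈ h.support, ∀ m₂ ∈ h.support, m₁.degree = m₂.degree) →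
      ∃ w : Fin n × Fin n → ℕ, CutsOut w (placedBlock eR eC) ∧
        ∀ m₁ ∈ (topComponent w h).support, ∀ m₂ ∈ (topComponent w h).support,
          ∀ e ∉ placedBlock eR eC, m₁ e = m₂ e := by
  intro b k m n eR eC h hk hdeg
  -- a permutation inside the placed face, from the diagonal perfect matching of `G(b,k) ⊕ M₀`
  obtain ⟨g, hg⟩ := exists_blockMatching b k m hk
  obtain ⟨σ₀, hσ₀⟩ := exists_perm_mem_placedBlock eR eC g hg
  refine ⟨genericWeight (placedBlock eR eC) (h.totalDegree + 1),
    cutsOut_genericWeight (placedBlock eR eC) (Nat.succ_pos _) σ₀ hσ₀, fun m₁ hm₁ m₂ hm₂ => ?_⟩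
  -- the top fibre agrees off `G`: both monomials lie in `h.support`, hence have the same degree
  exact eq_offG_of_mem_support_topComponent (placedBlock eR eC) hm₁ hm₂
    (hdeg m₁ (support_topComponent_subset _ h hm₁) m₂ (support_topComponent_subset _ h hm₂))

end Summit.ValiantsHypothesis.ValiantsHypothesis.Theorems.DivisionGapPerDivisionHard

end
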